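import Summits.FinalStateConjecture.FinalStateConjecture.Theorems.EIHFluxBalanceInertialRecessionStubChargeModelLLTranslate

/-!
# Route EIHFluxBalance — `InertialRecession`, line `sublinear-is-free-clean-window-charges`:
# the Landau–Lifshitz objects under a LINEAR change of chart (stub `stub_identification`, part A1a)

Helper file (`--supports stmt-FinalStateConjecture-10166`) for the crux
`Summit.FinalStateConjecture.FinalStateConjecture.Theses.EIHFluxBalance.InertialRecession`.

The identification of the window charges needs the Landau–Lifshitz four-momentum of a BOOSTED
Kerr–Schild hole, `boostedKerrBilin Λ c M a x = g_{M,a}(Λ⁻¹(x − c))(Λ⁻¹·, Λ⁻¹·)`: the pull-back of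
the static components by the linear change of chart `x ↦ Λ⁻¹ x` (and a translation, file
`…LLTranslate`). This file transports the derivative-free objects of
`LandauLifshitzPseudotensor.lean` and LL's `h^{μνα}` along an arbitrary continuous linear
automorphism `L` of `E4`: for `g' x (v, w) = g (L x) (L v, L w)` and `P` the matrix of `L`
(`(Matrix.of fun i j : Fin 4 ↦ ((L : E4 →L[ℝ] E4) (E4.basisVector j)) i)`, `P_{αμ} = (L ∂_μ)^α`), `Q = P⁻¹`,
* `gram g' x = Pᵀ (gram g (Lx)) P`, `det = (det P)² det`, `upper g' x = Q (upper g (Lx)) Qᵀ`;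
* `H'^{μανβ}(x) = (det P)² Σ Q_{μμ'}Q_{αα'}Q_{νν'}Q_{ββ'} H^{μ'α'ν'β'}(Lx)` (a tensor density);
* `h'^{μνα}(x) = (det P)² Σ Q_{μμ'}Q_{νν'}Q_{αα'} h^{μ'ν'α'}(Lx)` (chain rule: the derivative index
  of `h = (16π)⁻¹ ∂_β H^{μβνα}` contracts `P` against `Q`).
Landau–Lifshitz §96: `h^{ikl}` and `t^{ik}` "behave like tensors under linear transformations of the
coordinates". [cite: LandauLifshitz1975, §96]
-/

set_option linter.dupNamespace false

noncomputable section

open Set Filter Matrix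
open Literature.Geometry.Lorentzian Literature.Geometry.Lorentzian.LandauLifshitz

namespace Summit.FinalStateConjecture.FinalStateConjecture.Theorems

namespace SublinearIsFree.ChargeModel

/-! ### The matrix of a linear change of chart -/

/-- `L ∂_μ = Σ_α P_{αμ} ∂_α`. [folklore] -/
theorem apply_basisVector_eq_sum (L : E4 →L[ℝ] E4) (μ : Fin 4) :
    L (E4.basisVector μ) = ∑ α : Fin 4, (Matrix.of fun i j : Fin 4 ↦ ((L : E4 →L[ℝ] E4) (E4.basisVector j)) i) α μ • E4.basisVector α := by
  conv_lhs => rw [← (EuclideanSpace.basisFun (Fin 4) ℝ).sum_repr (L (E4.basisVector μ))]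
  simp [EuclideanSpace.basisFun_apply]

/-- Components of `L v`: `(L v)^α = Σ_μ P_{αμ} v^μ`, i.e. `L v = P v` on coordinates. [folklore] -/
theorem apply_eq_linChartMatrix_mulVec (L : E4 →L[ℝ] E4) (v : E4) (α : Fin 4) :
    L v α = ∑ μ : Fin 4, (Matrix.of fun i j : Fin 4 ↦ ((L : E4 →L[ℝ] E4) (E4.basisVector j)) i) α μ * v μ := by
  conv_lhs => rw [← (EuclideanSpace.basisFun (Fin 4) ℝ).sum_repr v, map_sum]
  simp only [EuclideanSpace.basisFun_repr, EuclideanSpace.basisFun_apply, map_smul,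
    WithLp.ofLp_sum, WithLp.ofLp_smul, Finset.sum_apply, Pi.smul_apply, smul_eq_mul,
    Matrix.of_apply]
  exact Finset.sum_congr rfl fun μ _ ↦ mul_comm _ _

/-- The matrix of a composition is the product of the matrices. [folklore] -/
theorem linChartMatrix_comp (L L' : E4 →L[ℝ] E4) :
    (Matrix.of fun i j : Fin 4 ↦ ((L.comp L' : E4 →L[ℝ] E4) (E4.basisVector j)) i) = (Matrix.of fun i j : Fin 4 ↦ ((L : E4 →L[ℝ] E4) (E4.basisVector j)) i) * (Matrix.of fun i j : Fin 4 ↦ ((L' : E4 →L[ℝ] E4) (E4.basisVector j)) i) := by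
  ext α μ
  rw [Matrix.of_apply, ContinuousLinearMap.comp_apply, apply_eq_linChartMatrix_mulVec,
    Matrix.mul_apply]
  rfl

/-- The matrix of the identity is `1`. [folklore] -/
theorem linChartMatrix_id : (Matrix.of fun i j : Fin 4 ↦ ((ContinuousLinearMap.id ℝ E4 : E4 →L[ℝ] E4) (E4.basisVector j)) i) = 1 := by
  ext α μ
  rw [Matrix.of_apply, ContinuousLinearMap.id_apply, Matrix.one_apply]
  by_cases h : α = μ
  · subst h; simp
  · rw [if_neg h]
    simp [h]

/-- For an automorphism `L`, the matrices of `L` and `L⁻¹` are inverse: `P · P(L⁻¹) = 1`.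
[folklore] -/
theorem linChartMatrix_mul_symm (L : E4 ≃L[ℝ] E4) :
    (Matrix.of fun i j : Fin 4 ↦ ((L : E4 →L[ℝ] E4) (E4.basisVector j)) i) * (Matrix.of fun i j : Fin 4 ↦ ((L.symm : E4 →L[ℝ] E4) (E4.basisVector j)) i) = 1 := by
  rw [← linChartMatrix_comp, ContinuousLinearEquiv.coe_comp_coe_symm, linChartMatrix_id]

/-- `P(L⁻¹) · P = 1`. [folklore] -/
theorem linChartMatrix_symm_mul (L : E4 ≃L[ℝ] E4) :
    (Matrix.of fun i j : Fin 4 ↦ ((L.symm : E4 →L[ℝ] E4) (E4.basisVector j)) i) * (Matrix.of fun i j : Fin 4 ↦ ((L : E4 →L[ℝ] E4) (E4.basisVector j)) i) = 1 := by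
  rw [← linChartMatrix_comp, ContinuousLinearEquiv.coe_symm_comp_coe, linChartMatrix_id]

/-- The matrix of `L⁻¹` is the matrix inverse of the matrix of `L`. [folklore] -/
theorem linChartMatrix_symm_eq_inv (L : E4 ≃L[ℝ] E4) :
    (Matrix.of fun i j : Fin 4 ↦ ((L.symm : E4 →L[ℝ] E4) (E4.basisVector j)) i) = ((Matrix.of fun i j : Fin 4 ↦ ((L : E4 →L[ℝ] E4) (E4.basisVector j)) i))⁻¹ :=
  (Matrix.inv_eq_right_inv (linChartMatrix_mul_symm L)).symm

/-- The matrix of an automorphism has nonzero determinant. [folklore] -/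
theorem det_linChartMatrix_ne_zero (L : E4 ≃L[ℝ] E4) : ((Matrix.of fun i j : Fin 4 ↦ ((L : E4 →L[ℝ] E4) (E4.basisVector j)) i)).det ≠ 0 := by
  intro h
  have h1 := congrArg Matrix.det (linChartMatrix_mul_symm L)
  rw [Matrix.det_mul, h, zero_mul, Matrix.det_one] at h1
  exact zero_ne_one h1

/-! ### The derivative-free objects under a linear change of chart -/

variable {g g' : E4 → E4 →L[ℝ] E4 →L[ℝ] ℝ}

/-- **Metric components**: `gram g' x = Pᵀ (gram g (Lx)) P` for `g' x (v, w) = g (Lx)(Lv, Lw)`.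
[cite: LandauLifshitz1975, §96] -/
theorem gram_linChart (L : E4 →L[ℝ] E4) (hg' : ∀ x v w, g' x v w = g (L x) (L v) (L w)) (x : E4) :
    gram g' x = ((Matrix.of fun i j : Fin 4 ↦ ((L : E4 →L[ℝ] E4) (E4.basisVector j)) i))ᵀ * gram g (L x) * (Matrix.of fun i j : Fin 4 ↦ ((L : E4 →L[ℝ] E4) (E4.basisVector j)) i) := by
  ext μ ν
  rw [gram_apply, hg', apply_basisVector_eq_sum L μ, apply_basisVector_eq_sum L ν]
  simp only [map_sum, map_smul, FunLike.coe_sum, FunLike.coe_smul,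
    Finset.sum_apply, Pi.smul_apply, smul_eq_mul, Finset.mul_sum, Matrix.mul_apply,
    Matrix.transpose_apply, gram_apply, Finset.sum_mul]
  trans ∑ a, ∑ b, (Matrix.of fun i j : Fin 4 ↦ ((L : E4 →L[ℝ] E4) (E4.basisVector j)) i) a ν * (Matrix.of fun i j : Fin 4 ↦ ((L : E4 →L[ℝ] E4) (E4.basisVector j)) i) b μ *
    g (L x) (E4.basisVector b) (E4.basisVector a)
  · refine Finset.sum_congr rfl fun a _ ↦ Finset.sum_congr rfl fun b _ ↦ ?_
    ring
  · refine Finset.sum_congr rfl fun a _ ↦ Finset.sum_congr rfl fun b _ ↦ ?_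
    ring

/-- **Determinant**: `det (g'_{μν})(x) = (det P)² det (g_{μν})(Lx)`. [cite: LandauLifshitz1975, §96] -/
theorem metricDet_linChart (L : E4 →L[ℝ] E4) (hg' : ∀ x v w, g' x v w = g (L x) (L v) (L w))
    (x : E4) : metricDet g' x = ((Matrix.of fun i j : Fin 4 ↦ ((L : E4 →L[ℝ] E4) (E4.basisVector j)) i)).det ^ 2 * metricDet g (L x) := by
  rw [metricDet, metricDet, gram_linChart L hg', Matrix.det_mul, Matrix.det_mul,
    Matrix.det_transpose]
  ring

/-- **Inverse components**: `upper g' x = Q (upper g (Lx)) Qᵀ`, `Q = P⁻¹` the matrix of `L⁻¹`,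
for an automorphism `L`. [cite: LandauLifshitz1975, §96] -/
theorem upper_linChart (L : E4 ≃L[ℝ] E4)
    (hg' : ∀ x v w, g' x v w = g (L x) (L v) (L w)) (x : E4) :
    upper g' x = (Matrix.of fun i j : Fin 4 ↦ ((L.symm : E4 →L[ℝ] E4) (E4.basisVector j)) i) * upper g (L x) *
      ((Matrix.of fun i j : Fin 4 ↦ ((L.symm : E4 →L[ℝ] E4) (E4.basisVector j)) i))ᵀ := by
  have hgram : gram g' x = ((Matrix.of fun i j : Fin 4 ↦ ((L : E4 →L[ℝ] E4) (E4.basisVector j)) i))ᵀ * gram g (L x) *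
      (Matrix.of fun i j : Fin 4 ↦ ((L : E4 →L[ℝ] E4) (E4.basisVector j)) i) := gram_linChart (L : E4 →L[ℝ] E4) hg' x
  rw [upper, upper, hgram, Matrix.mul_inv_rev, Matrix.mul_inv_rev, ← Matrix.transpose_nonsing_inv,
    linChartMatrix_symm_eq_inv, Matrix.mul_assoc]

/-- Components of `Q U Qᵀ`: `(Q U Qᵀ)_{ij} = Σ_{i'j'} Q_{ii'} Q_{jj'} U_{i'j'}`. [folklore] -/
theorem mul_mul_transpose_apply (Q U : Matrix (Fin 4) (Fin 4) ℝ) (i j : Fin 4) :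
    (Q * U * Qᵀ) i j = ∑ i', ∑ j', Q i i' * Q j j' * U i' j' := by
  simp only [Matrix.mul_apply, Matrix.transpose_apply, Finset.sum_mul]
  rw [Finset.sum_comm]
  refine Finset.sum_congr rfl fun i' _ ↦ Finset.sum_congr rfl fun j' _ ↦ ?_
  ring

/-- The quadratic expression of the superpotential in `U' = Q U Qᵀ` is the `Q⊗Q⊗Q⊗Q`-transform of
the same expression in `U`. [folklore] -/
theorem quadUpper_transform (Q U : Matrix (Fin 4) (Fin 4) ℝ) (μ α ν β : Fin 4) :
    (Q * U * Qᵀ) μ ν * (Q * U * Qᵀ) α β - (Q * U * Qᵀ) α ν * (Q * U * Qᵀ) μ β =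
      ∑ μ' : Fin 4, ∑ ν' : Fin 4, ∑ α' : Fin 4, ∑ β' : Fin 4,
        Q μ μ' * Q ν ν' * (Q α α' * Q β β') * (U μ' ν' * U α' β' - U α' ν' * U μ' β') := by
  simp only [mul_mul_transpose_apply]
  have h1 : (∑ i', ∑ j', Q μ i' * Q ν j' * U i' j') * (∑ i', ∑ j', Q α i' * Q β j' * U i' j') =
      ∑ μ', ∑ ν', ∑ α', ∑ β', Q μ μ' * Q ν ν' * (Q α α' * Q β β') * (U μ' ν' * U α' β') := by
    rw [Finset.sum_mul]
    refine Finset.sum_congr rfl fun μ' _ ↦ ?_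
    rw [Finset.sum_mul]
    refine Finset.sum_congr rfl fun ν' _ ↦ ?_
    rw [Finset.mul_sum]
    refine Finset.sum_congr rfl fun α' _ ↦ ?_
    rw [Finset.mul_sum]
    refine Finset.sum_congr rfl fun β' _ ↦ ?_
    ring
  have h2a : (∑ i', ∑ j', Q α i' * Q ν j' * U i' j') * (∑ i', ∑ j', Q μ i' * Q β j' * U i' j') =
      ∑ α', ∑ ν', ∑ μ', ∑ β', Q μ μ' * Q ν ν' * (Q α α' * Q β β') * (U α' ν' * U μ' β') := by
    rw [Finset.sum_mul]
    refine Finset.sum_congr rfl fun α' _ ↦ ?_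
    rw [Finset.sum_mul]
    refine Finset.sum_congr rfl fun ν' _ ↦ ?_
    rw [Finset.mul_sum]
    refine Finset.sum_congr rfl fun μ' _ ↦ ?_
    rw [Finset.mul_sum]
    refine Finset.sum_congr rfl fun β' _ ↦ ?_
    ring
  have h2b : (∑ α', ∑ ν', ∑ μ', ∑ β', Q μ μ' * Q ν ν' * (Q α α' * Q β β') * (U α' ν' * U μ' β')) =
      ∑ μ', ∑ ν', ∑ α', ∑ β', Q μ μ' * Q ν ν' * (Q α α' * Q β β') * (U α' ν' * U μ' β') := by
    calc (∑ α', ∑ ν', ∑ μ', ∑ β', Q μ μ' * Q ν ν' * (Q α α' * Q β β') * (U α' ν' * U μ' β'))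
        = ∑ ν', ∑ α', ∑ μ', ∑ β', Q μ μ' * Q ν ν' * (Q α α' * Q β β') * (U α' ν' * U μ' β') :=
          Finset.sum_comm
      _ = ∑ ν', ∑ μ', ∑ α', ∑ β', Q μ μ' * Q ν ν' * (Q α α' * Q β β') * (U α' ν' * U μ' β') :=
          Finset.sum_congr rfl fun ν' _ ↦ Finset.sum_comm
      _ = ∑ μ', ∑ ν', ∑ α', ∑ β', Q μ μ' * Q ν ν' * (Q α α' * Q β β') * (U α' ν' * U μ' β') :=
          Finset.sum_comm
  rw [h1, h2a, h2b, ← Finset.sum_sub_distrib]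
  refine Finset.sum_congr rfl fun μ' _ ↦ ?_
  rw [← Finset.sum_sub_distrib]
  refine Finset.sum_congr rfl fun ν' _ ↦ ?_
  rw [← Finset.sum_sub_distrib]
  refine Finset.sum_congr rfl fun α' _ ↦ ?_
  rw [← Finset.sum_sub_distrib]
  refine Finset.sum_congr rfl fun β' _ ↦ ?_
  ring

/-- **The superpotential is a tensor density under linear changes of chart**:
`H'^{μανβ}(x) = (det P)² Σ Q_{μμ'} Q_{νν'} Q_{αα'} Q_{ββ'} H^{μ'α'ν'β'}(Lx)`, `Q` the matrix of `L⁻¹`.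
[cite: LandauLifshitz1975, §96 (96.3)] -/
theorem superpotential_linChart (L : E4 ≃L[ℝ] E4)
    (hg' : ∀ x v w, g' x v w = g (L x) (L v) (L w)) (x : E4) (μ α ν β : Fin 4) :
    superpotential g' x μ α ν β = ((Matrix.of fun i j : Fin 4 ↦ ((L : E4 →L[ℝ] E4) (E4.basisVector j)) i)).det ^ 2 *
      ∑ μ' : Fin 4, ∑ ν' : Fin 4, ∑ α' : Fin 4, ∑ β' : Fin 4,
        (Matrix.of fun i j : Fin 4 ↦ ((L.symm : E4 →L[ℝ] E4) (E4.basisVector j)) i) μ μ' * (Matrix.of fun i j : Fin 4 ↦ ((L.symm : E4 →L[ℝ] E4) (E4.basisVector j)) i) ν ν' *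
        ((Matrix.of fun i j : Fin 4 ↦ ((L.symm : E4 →L[ℝ] E4) (E4.basisVector j)) i) α α' * (Matrix.of fun i j : Fin 4 ↦ ((L.symm : E4 →L[ℝ] E4) (E4.basisVector j)) i) β β') *
        superpotential g (L x) μ' α' ν' β' := by
  have hdet : metricDet g' x = ((Matrix.of fun i j : Fin 4 ↦ ((L : E4 →L[ℝ] E4) (E4.basisVector j)) i)).det ^ 2 * metricDet g (L x) :=
    metricDet_linChart (L : E4 →L[ℝ] E4) hg' x
  rw [superpotential, hdet, upper_linChart L hg', quadUpper_transform, Finset.mul_sum,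
    Finset.mul_sum]
  refine Finset.sum_congr rfl fun μ' _ ↦ ?_
  rw [Finset.mul_sum, Finset.mul_sum]
  refine Finset.sum_congr rfl fun ν' _ ↦ ?_
  rw [Finset.mul_sum, Finset.mul_sum]
  refine Finset.sum_congr rfl fun α' _ ↦ ?_
  rw [Finset.mul_sum, Finset.mul_sum]
  refine Finset.sum_congr rfl fun β' _ ↦ ?_
  rw [superpotential]
  ring

/-! ### Derivatives under a linear change of chart: LL's `h^{μνα}` -/

/-- **Chain rule for coordinate partials**: `∂_β (F ∘ L)(x) = Σ_γ P_{γβ} (∂_γ F)(Lx)`.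
[folklore] -/
theorem partialDeriv_comp_linChart (L : E4 ≃L[ℝ] E4) (F : E4 → ℝ) (x : E4) (β : Fin 4) :
    partialDeriv β (fun y ↦ F (L y)) x =
      ∑ γ : Fin 4, (Matrix.of fun i j : Fin 4 ↦ ((L : E4 →L[ℝ] E4) (E4.basisVector j)) i) γ β * partialDeriv γ F (L x) := by
  rw [partialDeriv, show (fun y ↦ F (L y)) = F ∘ ⇑L from rfl, L.comp_right_fderiv,
    ContinuousLinearMap.comp_apply, apply_basisVector_eq_sum (L : E4 →L[ℝ] E4) β]
  simp only [map_sum, map_smul, smul_eq_mul, partialDeriv]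

/-- Four-fold sums of differentiable functions are differentiable, with the summed derivative.
[folklore] -/
theorem hasFDerivAt_sum_four {f : Fin 4 → Fin 4 → Fin 4 → Fin 4 → E4 → ℝ}
    {f' : Fin 4 → Fin 4 → Fin 4 → Fin 4 → E4 →L[ℝ] ℝ} {x : E4}
    (h : ∀ a b c d, HasFDerivAt (f a b c d) (f' a b c d) x) :
    HasFDerivAt (fun y ↦ ∑ a, ∑ b, ∑ c, ∑ d, f a b c d y) (∑ a, ∑ b, ∑ c, ∑ d, f' a b c d) x :=
  HasFDerivAt.fun_sum fun a _ ↦ HasFDerivAt.fun_sum fun b _ ↦ HasFDerivAt.fun_sum fun c _ ↦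
    HasFDerivAt.fun_sum fun d _ ↦ h a b c d

/-- `Σ_b Σ_{α'} Q_{bα'} P_{γb} Y_{α'} = Y_γ`: the derivative index contracts the chart matrix
against its inverse. [folklore] -/
theorem sum_sum_linChartMatrix_symm_mul (L : E4 ≃L[ℝ] E4) (γ : Fin 4) (Y : Fin 4 → ℝ) :
    ∑ b : Fin 4, ∑ α' : Fin 4,
      (Matrix.of fun i j : Fin 4 ↦ ((L.symm : E4 →L[ℝ] E4) (E4.basisVector j)) i) b α' * (Matrix.of fun i j : Fin 4 ↦ ((L : E4 →L[ℝ] E4) (E4.basisVector j)) i) γ b * Y α' = Y γ := by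
  rw [Finset.sum_comm]
  have h : ∀ α' : Fin 4, ∑ b : Fin 4, (Matrix.of fun i j : Fin 4 ↦ ((L.symm : E4 →L[ℝ] E4) (E4.basisVector j)) i) b α' *
      (Matrix.of fun i j : Fin 4 ↦ ((L : E4 →L[ℝ] E4) (E4.basisVector j)) i) γ b * Y α' = (1 : Matrix (Fin 4) (Fin 4) ℝ) γ α' * Y α' := by
    intro α'
    rw [← linChartMatrix_mul_symm L, Matrix.mul_apply, Finset.sum_mul]
    refine Finset.sum_congr rfl fun b _ ↦ ?_
    ring
  simp only [h, Matrix.one_apply, ite_mul, one_mul, zero_mul, Finset.sum_ite_eq, Finset.mem_univ,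
    if_true]

/-- `Σ_b Σ_{α'} Σ_γ Q_{bα'} P_{γb} Y_{α'γ} = Σ_γ Y_{γγ}` (contraction of the derivative index).
[folklore] -/
theorem sum_three_contract (L : E4 ≃L[ℝ] E4) (Y : Fin 4 → Fin 4 → ℝ) :
    ∑ b : Fin 4, ∑ α' : Fin 4, ∑ γ : Fin 4,
      (Matrix.of fun i j : Fin 4 ↦ ((L.symm : E4 →L[ℝ] E4) (E4.basisVector j)) i) b α' * (Matrix.of fun i j : Fin 4 ↦ ((L : E4 →L[ℝ] E4) (E4.basisVector j)) i) γ b * Y α' γ =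
      ∑ γ : Fin 4, Y γ γ := by
  have h1 : (∑ b : Fin 4, ∑ α' : Fin 4, ∑ γ : Fin 4,
      (Matrix.of fun i j : Fin 4 ↦ ((L.symm : E4 →L[ℝ] E4) (E4.basisVector j)) i) b α' * (Matrix.of fun i j : Fin 4 ↦ ((L : E4 →L[ℝ] E4) (E4.basisVector j)) i) γ b * Y α' γ) =
      ∑ b : Fin 4, ∑ γ : Fin 4, ∑ α' : Fin 4,
        (Matrix.of fun i j : Fin 4 ↦ ((L.symm : E4 →L[ℝ] E4) (E4.basisVector j)) i) b α' * (Matrix.of fun i j : Fin 4 ↦ ((L : E4 →L[ℝ] E4) (E4.basisVector j)) i) γ b * Y α' γ :=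
    Finset.sum_congr rfl fun b _ ↦ Finset.sum_comm
  rw [h1, Finset.sum_comm]
  exact Finset.sum_congr rfl fun γ _ ↦ sum_sum_linChartMatrix_symm_mul L γ (fun α' ↦ Y α' γ)

/-- **LL's `h^{μνα}` is a tensor density under linear changes of chart**:
`h'^{μνα}(x) = (det P)² Σ Q_{μμ'} Q_{νν'} Q_{αα'} h^{μ'ν'α'}(Lx)`, provided the superpotential of `g`
is differentiable at `Lx`. [cite: LandauLifshitz1975, §96 (96.2)] -/
theorem hField_linChart (L : E4 ≃L[ℝ] E4) (hg' : ∀ x v w, g' x v w = g (L x) (L v) (L w))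
    {x : E4} (hH : ∀ μ α ν β, DifferentiableAt ℝ (fun y ↦ superpotential g y μ α ν β) (L x))
    (μ ν α : Fin 4) :
    hField g' x μ ν α = ((Matrix.of fun i j : Fin 4 ↦ ((L : E4 →L[ℝ] E4) (E4.basisVector j)) i)).det ^ 2 *
      ∑ μ' : Fin 4, ∑ ν' : Fin 4, ∑ α' : Fin 4,
        (Matrix.of fun i j : Fin 4 ↦ ((L.symm : E4 →L[ℝ] E4) (E4.basisVector j)) i) μ μ' * (Matrix.of fun i j : Fin 4 ↦ ((L.symm : E4 →L[ℝ] E4) (E4.basisVector j)) i) ν ν' *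
        (Matrix.of fun i j : Fin 4 ↦ ((L.symm : E4 →L[ℝ] E4) (E4.basisVector j)) i) α α' * hField g (L x) μ' ν' α' := by
  set P : Matrix (Fin 4) (Fin 4) ℝ := (Matrix.of fun i j : Fin 4 ↦ ((L : E4 →L[ℝ] E4) (E4.basisVector j)) i) with hP
  set Q : Matrix (Fin 4) (Fin 4) ℝ := (Matrix.of fun i j : Fin 4 ↦ ((L.symm : E4 →L[ℝ] E4) (E4.basisVector j)) i) with hQ
  -- the partial derivatives of the transformed superpotential
  have hpd : ∀ b : Fin 4, partialDeriv b (fun y ↦ superpotential g' y μ b ν α) x =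
      P.det ^ 2 * ∑ μ', ∑ ν', ∑ α', ∑ β', Q μ μ' * Q ν ν' * (Q b α' * Q α β') *
        ∑ γ, P γ b * partialDeriv γ (fun z ↦ superpotential g z μ' α' ν' β') (L x) := by
    intro b
    have hfun : (fun y ↦ superpotential g' y μ b ν α) = fun y ↦ P.det ^ 2 *
        ∑ μ', ∑ ν', ∑ α', ∑ β', Q μ μ' * Q ν ν' * (Q b α' * Q α β') *
          superpotential g (L y) μ' α' ν' β' :=
      funext fun y ↦ superpotential_linChart L hg' y μ b ν α
    have hcomp : ∀ μ' α' ν' β', HasFDerivAt (fun y ↦ superpotential g (L y) μ' α' ν' β')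
        ((fderiv ℝ (fun z ↦ superpotential g z μ' α' ν' β') (L x)).comp (L : E4 →L[ℝ] E4)) x :=
      fun μ' α' ν' β' ↦ (hH μ' α' ν' β').hasFDerivAt.comp x (L : E4 →L[ℝ] E4).hasFDerivAt
    have hder := (hasFDerivAt_sum_four fun μ' ν' α' β' ↦
      (hcomp μ' α' ν' β').const_mul (Q μ μ' * Q ν ν' * (Q b α' * Q α β'))).const_mul (P.det ^ 2)
    rw [partialDeriv, hfun, hder.fderiv]
    simp only [FunLike.coe_smul, Pi.smul_apply, FunLike.coe_sum, Finset.sum_apply,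
      smul_eq_mul, ContinuousLinearMap.comp_apply]
    refine congrArg _ (Finset.sum_congr rfl fun μ' _ ↦ Finset.sum_congr rfl fun ν' _ ↦
      Finset.sum_congr rfl fun α' _ ↦ Finset.sum_congr rfl fun β' _ ↦ ?_)
    rw [apply_basisVector_eq_sum (L : E4 →L[ℝ] E4) b]
    simp only [map_sum, map_smul, smul_eq_mul, partialDeriv]
    rw [← hP]
  -- fully distributed form, summation order `μ' ν' β' α' γ`
  have hpd' : ∀ b : Fin 4, partialDeriv b (fun y ↦ superpotential g' y μ b ν α) x =
      ∑ μ', ∑ ν', ∑ β', ∑ α', ∑ γ, Q b α' * P γ b * (P.det ^ 2 * (Q μ μ' * Q ν ν' * Q α β') *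
        partialDeriv γ (fun z ↦ superpotential g z μ' α' ν' β') (L x)) := by
    intro b
    rw [hpd b]
    simp only [Finset.mul_sum]
    refine Finset.sum_congr rfl fun μ' _ ↦ Finset.sum_congr rfl fun ν' _ ↦ ?_
    rw [Finset.sum_comm]
    refine Finset.sum_congr rfl fun β' _ ↦ Finset.sum_congr rfl fun α' _ ↦
      Finset.sum_congr rfl fun γ _ ↦ ?_
    ring
  -- assemble `h = (16π)⁻¹ Σ_b ∂_b H^{μ b ν α}`, move `Σ_b` inside and contract
  rw [hField]
  simp only [hpd']
  rw [Finset.sum_comm, Finset.mul_sum, Finset.mul_sum]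
  refine Finset.sum_congr rfl fun μ' _ ↦ ?_
  rw [Finset.sum_comm, Finset.mul_sum, Finset.mul_sum]
  refine Finset.sum_congr rfl fun ν' _ ↦ ?_
  rw [Finset.sum_comm, Finset.mul_sum, Finset.mul_sum]
  refine Finset.sum_congr rfl fun β' _ ↦ ?_
  rw [sum_three_contract L (fun α' γ ↦ P.det ^ 2 * (Q μ μ' * Q ν ν' * Q α β') *
    partialDeriv γ (fun z ↦ superpotential g z μ' α' ν' β') (L x)), hField, Finset.mul_sum,
    Finset.mul_sum, Finset.mul_sum]
  rw [Finset.mul_sum]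
  refine Finset.sum_congr rfl fun γ _ ↦ ?_
  ring

end SublinearIsFree.ChargeModel

/-- Registered sub-goal form (stub `hField_linearChangeOfChart` of the crux item) of
`SublinearIsFree.ChargeModel.hField_linChart`: LL's `h^{μνα}` is a tensor density under linear
changes of chart. [cite: LandauLifshitz1975, §96 (96.2)] -/
theorem hField_linearChangeOfChart : open Literature.Geometry.Lorentzian in ∀ (g g' : E4 → E4 →L[ℝ] E4 →L[ℝ] ℝ) (L : E4 ≃L[ℝ] E4), (∀ x v w : E4, g' x v w = g (L x) (L v) (L w)) → ∀ (x : E4), (∀ μ α ν β : Fin 4, DifferentiableAt ℝ (fun y ↦ LandauLifshitz.superpotential g y μ α ν β) (L x)) → ∀ μ ν α : Fin 4, LandauLifshitz.hField g' x μ ν α = (Matrix.of fun i j : Fin 4 ↦ ((L : E4 →L[ℝ] E4) (E4.basisVector j)) i).det ^ 2 * ∑ μ' : Fin 4, ∑ ν' : Fin 4, ∑ α' : Fin 4, (Matrix.of fun i j : Fin 4 ↦ ((L.symm : E4 →L[ℝ] E4) (E4.basisVector j)) i) μ μ' * (Matrix.of fun i j : Fin 4 ↦ ((L.symm : E4 →L[ℝ]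 E4) (E4.basisVector j)) i) ν ν' * (Matrix.of fun i j : Fin 4 ↦ ((L.symm : E4 →L[ℝ] E4) (E4.basisVector j)) i) α α' * LandauLifshitz.hField g (L x) μ' ν' α' :=
  fun _g _g' L hg' _x hH μ ν α ↦ SublinearIsFree.ChargeModel.hField_linChart L hg' hH μ ν α

end Summit.FinalStateConjecture.FinalStateConjecture.Theorems

end
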